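import Summits.Ventures.HSemireg.WedgeHankelRecurrenceCommonRoots
import Summits.Ventures.HSemireg.WedgeHankelRecurrencePoleCount
import Summits.Ventures.HSemireg.WedgeHankelRecurrenceResultant

/-!
# Venture HSemireg — COPRIMALITY READ OFF THE NEWTON-SUM HANKEL RANKS: for `m` monic of degree `t + 1` over a field of CHARACTERISTIC `0` and any `a ∈ K[X]`,
# **`IsCoprime m a ⟺ rank H_t(a·m′/m) = rank H_t(m′/m) ⟺ Res(m, a) ≠ 0`** — weighting the Newton sums by `a` loses rank exactly when `a` shares a root with `m` (N113's common-root count;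
# N115 gives `⇐`-free direction `IsCoprime ⇒` equal ranks over EVERY field; the converse needs characteristic `0`: for `m = X^p` in characteristic `p` both ranks are `0` although `(X^p, X) ≠ 1`).
# On the way: `IsCoprime m a ⟺ a` vanishes at no root of `φm`, for any embedding `φ` under which `m` splits.

HONEST FRAMING. Part of the Lean index of the computation cell `pub-hsemireg` (seat p10 gen 32, Sunday typer «UNIFORM-IN-n»).
LINEAR ALGEBRA OF HANKEL (catalecticant) MATRICES and of polynomials over a field ONLY (`IsCoprime`, `EuclideanDomain.gcd`, `Polynomial.resultant`, `Polynomial.roots`): no variety, no cohomology theory,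
no sheaf, no Ext group and no semiregularity map is constructed here; nothing here says that HC / HC_CM / HC_AV holds; no Literature fact is declared or used.  Custodian versions as in
`WedgeHankelSiegelIdeal` (1/3).

WHAT IS IN THE TREE.  N113 (`WedgeHankelRecurrenceCommonRoots`): `rank_hankelSq_dualSeq_mul_derivative_add_card_common_of_charZero` (`rank H_t(a·m′/m) + #{common distinct roots} = rank H_t(m′/m)`),
`rank_hankelSq_dualSeq_mul_derivative_le`.  N115 (`WedgeHankelRecurrencePoleCount`): `rank_hankelSq_dualSeq_mul_eq_of_isCoprime` (`(m, a) = 1 ⇒ rank H_t(a·b/m) = rank H_t(b/m)`, EVERY field — used,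
not restated).  N94 (`WedgeHankelRecurrenceResultant`): `resultant_ne_zero_iff_isCoprime_of_monic`.  N110: `rank_hankelSq_dualSeq_derivative_X_pow_char`, `dualSeq_zero_right`.  N96: `natDegree_gcd_eq_zero_of_isCoprime`
(via N45).  Mathlib: `EuclideanDomain.gcd_isUnit_iff` (`IsUnit (gcd x y) ↔ IsCoprime x y`), `Splits.exists_eval_eq_zero`, `Splits.of_dvd`, `IsCoprime.map`, `Polynomial.isCoprime_iff_aeval_ne_zero_of_isAlgClosed`
(the algebraically-closed form of §700; here any splitting embedding).
THIS FILE (namespace `Summit.Ventures.HSemireg.Wedge.HankelOuter` continued; CHAINED on N113 + N115; 0 definitions):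
* §700 `eval_ne_zero_of_isCoprime_of_isRoot` (coprime ⇒ no common root, any commutative setting used: a field), **`isCoprime_iff_forall_eval_map_ne_zero`** (`m ≠ 0` split under `φ`:
  `IsCoprime m a ⟺ ∀ λ ∈ roots(φm), (φa)(λ) ≠ 0`).
* §701 **`isCoprime_iff_rank_hankelSq_dualSeq_mul_derivative_eq`** (characteristic `0`), `resultant_ne_zero_iff_rank_hankelSq_dualSeq_mul_derivative_eq` (characteristic `0`),
  **`rank_hankelSq_dualSeq_mul_derivative_eq_X_pow_char`** (characteristic `p`: `m = X^p`, `a = X` — equal ranks `0 = 0` but NOT coprime: the converse fails without the characteristic hypothesis).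
Nothing Ext-side.  New names only.
-/

open Module Polynomial
open scoped Matrix Polynomial

namespace Summit.Ventures.HSemireg.Wedge.HankelOuter

open Summit.Ventures.HSemireg.Wedge Summit.Ventures.HSemireg.Wedge.Hankel

variable (K : Type*) [Field K]

/-! ## §700. Coprime ⟺ no common root in a splitting field -/

/-- Coprime polynomials have no common root: `IsCoprime f g → f(c) = 0 → g(c) ≠ 0` (Bezout evaluated at `c`). -/
theorem eval_ne_zero_of_isCoprime_of_isRoot {L : Type*} [Field L] {f g : L[X]} (h : IsCoprime f g) {c : L} (hf : f.IsRoot c) : g.eval c ≠ 0 := by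
  obtain ⟨u, v, huv⟩ := h
  intro hg
  have h1 := congrArg (Polynomial.eval c) huv
  rw [Polynomial.eval_add, Polynomial.eval_mul, Polynomial.eval_mul, hf.eq_zero, hg, mul_zero, mul_zero, add_zero, Polynomial.eval_one] at h1
  exact zero_ne_one h1

/-- **`IsCoprime m a ⟺ a` vanishes at NO root of `φm`**, for `m ≠ 0` and any field embedding `φ` under which `m` splits (`⇒`: Bezout; `⇐`: a non-unit `gcd(m, a)` divides `m`, so it splits
under `φ` and has a root, which is a common root). Mathlib has the algebraically-closed form `isCoprime_iff_aeval_ne_zero_of_isAlgClosed`. -/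
theorem isCoprime_iff_forall_eval_map_ne_zero [DecidableEq K] {L : Type*} [Field L] (φ : K →+* L) {m : K[X]} (hm : m ≠ 0) (hs : (m.map φ).Splits) (a : K[X]) :
    IsCoprime m a ↔ ∀ c ∈ (m.map φ).roots, (a.map φ).eval c ≠ 0 := by
  refine ⟨fun h c hc => eval_ne_zero_of_isCoprime_of_isRoot (h.map (Polynomial.mapRingHom φ)) ((Polynomial.mem_roots (Polynomial.map_ne_zero hm)).mp hc), fun h => ?_⟩
  by_contra hcop
  -- the gcd is a non-unit divisor of `m`, hence of positive degree, hence has a root under `φ`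
  set g := EuclideanDomain.gcd m a with hg
  have hgu : ¬ IsUnit g := fun hu => hcop (EuclideanDomain.gcd_isUnit_iff.mp hu)
  have hg0 : g ≠ 0 := fun h0 => hm (EuclideanDomain.gcd_eq_zero_iff.mp h0).1
  have hgdeg : g.degree ≠ 0 := fun hd => hgu (Polynomial.isUnit_iff_degree_eq_zero.mpr hd)
  have hgs : (g.map φ).Splits := hs.of_dvd (Polynomial.map_ne_zero hm) (Polynomial.map_dvd φ (EuclideanDomain.gcd_dvd_left m a))
  obtain ⟨c, hc⟩ := hgs.exists_eval_eq_zero (by rwa [Polynomial.degree_map])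
  have hcm : c ∈ (m.map φ).roots := (Polynomial.mem_roots (Polynomial.map_ne_zero hm)).mpr
    (Polynomial.IsRoot.dvd (p := g.map φ) hc (Polynomial.map_dvd φ (EuclideanDomain.gcd_dvd_left m a)))
  exact h c hcm (Polynomial.eval_eq_zero_of_dvd_of_eval_eq_zero (Polynomial.map_dvd φ (EuclideanDomain.gcd_dvd_right m a)) hc)

/-! ## §701. Characteristic `0`: coprimality as «no rank drop» -/

/-- **`IsCoprime m a ⟺ rank H_t(a·m′/m) = rank H_t(m′/m)`** for `m` monic of degree `t + 1` over a field of CHARACTERISTIC `0` (N115: `⇒` over every field; `⇐`: in the splitting field the rank drop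
counts the common distinct roots (N113), and no common root means coprime (§700)). -/
theorem isCoprime_iff_rank_hankelSq_dualSeq_mul_derivative_eq [DecidableEq K] [CharZero K] {t : ℕ} {m : K[X]} (hm : m.Monic) (hmd : m.natDegree = t + 1) (a : K[X]) :
    IsCoprime m a ↔ (hankelSq K t (dualSeq K m (a * derivative m))).rank = (hankelSq K t (dualSeq K m (derivative m))).rank := by
  classical
  refine ⟨fun h => rank_hankelSq_dualSeq_mul_eq_of_isCoprime K hm hmd h (derivative m), fun h => ?_⟩
  let L := m.SplittingField
  let φ := algebraMap K L
  have hs : (m.map φ).Splits := SplittingField.splits m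
  have hsum := rank_hankelSq_dualSeq_mul_derivative_add_card_common_of_charZero K φ hm hmd hs a
  rw [h] at hsum
  have h0 : ((m.map φ).roots.toFinset.filter fun c => (a.map φ).IsRoot c).card = 0 := by omega
  refine (isCoprime_iff_forall_eval_map_ne_zero K φ hm.ne_zero hs a).mpr fun c hc hac => ?_
  exact Finset.card_ne_zero_of_mem (Finset.mem_filter.mpr ⟨Multiset.mem_toFinset.mpr hc, hac⟩) h0

/-- **`Res(m, a) ≠ 0 ⟺ rank H_t(a·m′/m) = rank H_t(m′/m)`** (`m` monic of degree `t + 1`, characteristic `0`; N94's `Res ≠ 0 ⟺ coprime`). -/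
theorem resultant_ne_zero_iff_rank_hankelSq_dualSeq_mul_derivative_eq [DecidableEq K] [CharZero K] {t : ℕ} {m : K[X]} (hm : m.Monic) (hmd : m.natDegree = t + 1) (a : K[X]) :
    Polynomial.resultant m a ≠ 0 ↔ (hankelSq K t (dualSeq K m (a * derivative m))).rank = (hankelSq K t (dualSeq K m (derivative m))).rank := by
  rw [resultant_ne_zero_iff_isCoprime_of_monic K hm (by omega) a, isCoprime_iff_rank_hankelSq_dualSeq_mul_derivative_eq K hm hmd a]

/-- **The converse FAILS in characteristic `p`: for `m = X^p` and `a = X` both Hankel matrices vanish (`m′ = 0`), so the ranks agree (`0 = 0`), yet `(X^p, X) ≠ 1`.** -/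
theorem rank_hankelSq_dualSeq_mul_derivative_eq_X_pow_char [DecidableEq K] (p : ℕ) [Fact p.Prime] [CharP K p] :
    (hankelSq K (p - 1) (dualSeq K ((Polynomial.X : K[X]) ^ p) (Polynomial.X * derivative ((Polynomial.X : K[X]) ^ p)))).rank
        = (hankelSq K (p - 1) (dualSeq K ((Polynomial.X : K[X]) ^ p) (derivative ((Polynomial.X : K[X]) ^ p)))).rank ∧
      ¬ IsCoprime ((Polynomial.X : K[X]) ^ p) Polynomial.X := by
  have hd : derivative ((Polynomial.X : K[X]) ^ p) = 0 := by rw [Polynomial.derivative_X_pow, CharP.cast_eq_zero, map_zero, zero_mul]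
  refine ⟨by rw [hd, mul_zero], fun h => ?_⟩
  -- a common root `0`
  have h0 : ((Polynomial.X : K[X]) ^ p).IsRoot 0 := by
    rw [Polynomial.IsRoot, Polynomial.eval_pow, Polynomial.eval_X, zero_pow (Nat.Prime.ne_zero Fact.out)]
  exact eval_ne_zero_of_isCoprime_of_isRoot h h0 (by rw [Polynomial.eval_X])

end Summit.Ventures.HSemireg.Wedge.HankelOuter
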